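import Literature.Analysis.FluidPDE.AxisymShellSobolev
import HarnessLib

/-!
# Even moments of swirl-free axially symmetric fields supported off the axis

Analysis/FluidPDE support file (everything proved; no definitions) on the decomposition path of
the named fact `SereginZajaczkowski2007.OffAxisPoloidalBound` (G. Seregin, W. Zajaczkowski,
SIAM J. Math. Anal. 39 (2007) 669–685 = arXiv:math/0702720, Lemma 4.2). The last step of the proof
of that lemma passes from the `L²` bound on `∇_a Ṽ`, `Ṽ = V^a ψ` the cut-off poloidal part
(`V^a = (V_ϱ, V₃)`), to `L^q` bounds: "and thus `∫∫ |Ṽ(x, t)|^q dϱ dx₃ ≤ Φ₄(q, 𝒜₂)` for all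
`t ∈ ]-2², 0[`" (arXiv p. 6) — the two-dimensional Sobolev embedding for the two components
`Ṽ_ϱ`, `Ṽ₃`, which are axially symmetric scalars compactly supported in the shell.

This file proves that step for an arbitrary swirl-free (poloidal) axially symmetric `C¹` vector
field `W` on `ℝ³` with compact support inside a shell `{ϱ₀ ≤ |x'| ≤ ϱ₁}`, `ϱ₀ > 0`, and all even
exponents:

`exists_even_moment_const_of_hasNoSwirl`: for `0 < ϱ₀ ≤ ϱ₁`, `m ≥ 1` there is `C ≥ 0` with
`∫ ‖W‖^{2m} ≤ C (∫ ‖W‖²) (∫ ‖DW‖² + ∫ ‖W‖²)^{m-1}`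
for all such `W` (`‖DW‖` the operator norm of the derivative).

Proof: the two scalars `A = y₀W₀ + y₁W₁` (`= ϱ W_ϱ`) and `B = W₂` are `C¹`, compactly supported,
axially symmetric and supported in the shell, with `A² ≤ ϱ₁² ‖W‖²`, `‖DA‖ ≤ ‖W‖ + ϱ₁‖DW‖`,
`B² ≤ ‖W‖²`, `‖DB‖ ≤ ‖DW‖`; since `W` has no swirl (`y₀W₁ - y₁W₀ = 0`),
`ϱ²(W₀² + W₁²) = A²`, so `‖W‖² ≤ A²/ϱ₀² + B²` and `‖W‖^{2m} ≤ 2^{m-1}((A²/ϱ₀²)^m + B^{2m})`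
(Mathlib's `add_pow_le`);
the accepted even-moment bound `exists_axisym_even_moment_const` (two-dimensional Sobolev in
the variables `(ϱ, x₃)`, `AxisymShellSobolev`) applied to `A` and `B` concludes.

## References

* G. Seregin, W. Zajaczkowski, SIAM J. Math. Anal. 39 (2007) 669–685, arXiv:math/0702720, proof
  of Lemma 4.2, last display (arXiv p. 6). [`SereginZajaczkowski2007`]
-/

noncomputable section

open MeasureTheory Set Function Filter Topology TopologicalSpace Metric InnerProductSpace
open scoped RealInnerProductSpace ENNReal NNReal Topology

namespace Literature.Analysis.FluidPDE

/-! ### Elementary inequalities -/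

/-- Rotations about the axis preserve the horizontal pairing `y₀w₀ + y₁w₁`. [folklore] -/
theorem horizontal_inner_rotZ (θ : ℝ) (y w : EuclideanSpace ℝ (Fin 3)) :
    rotZ θ y 0 * rotZ θ w 0 + rotZ θ y 1 * rotZ θ w 1 = y 0 * w 0 + y 1 * w 1 := by
  simp only [rotZ_apply_zero, rotZ_apply_one]
  linear_combination (y 0 * w 0 + y 1 * w 1) * Real.sin_sq_add_cos_sq θ

/-- `|x₀u₀ + x₁u₁| ≤ ϱ(x) ‖u‖` (Cauchy–Schwarz in the horizontal plane; the tree's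
`abs_horizontal_inner_le` of `AxisymVorticityAlgebra`, restated with `cylRadius` to keep the
imports light). [folklore] -/
theorem abs_horizontal_inner_le_cylRadius_mul (x u : EuclideanSpace ℝ (Fin 3)) :
    |x 0 * u 0 + x 1 * u 1| ≤ cylRadius x * ‖u‖ := by
  have hu : ‖u‖ ^ 2 = u 0 ^ 2 + u 1 ^ 2 + u 2 ^ 2 := by
    rw [EuclideanSpace.norm_sq_eq, Fin.sum_univ_three]
    simp only [Real.norm_eq_abs, sq_abs]
  have h1 : (x 0 * u 0 + x 1 * u 1) ^ 2 ≤ (x 0 ^ 2 + x 1 ^ 2) * ‖u‖ ^ 2 := by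
    rw [hu]
    nlinarith [sq_nonneg (x 0 * u 1 - x 1 * u 0), sq_nonneg (u 2), sq_nonneg (x 0),
      sq_nonneg (x 1),
      mul_nonneg (add_nonneg (sq_nonneg (x 0)) (sq_nonneg (x 1))) (sq_nonneg (u 2))]
  calc |x 0 * u 0 + x 1 * u 1| ≤ Real.sqrt ((x 0 ^ 2 + x 1 ^ 2) * ‖u‖ ^ 2) := Real.abs_le_sqrt h1
    _ = cylRadius x * ‖u‖ := by
        rw [Real.sqrt_mul (by positivity), Real.sqrt_sq (norm_nonneg _)]
        rfl

/-! ### The two scalar profiles of a poloidal field -/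

section Profiles

variable {W : EuclideanSpace ℝ (Fin 3) → EuclideanSpace ℝ (Fin 3)}

/-- For a swirl-free field, `ϱ² (W₀² + W₁²) = (y₀W₀ + y₁W₁)²` (Lagrange's identity with
`y₀W₁ - y₁W₀ = 0`). [folklore] -/
theorem cylRadius_sq_mul_horizontal_sq (hsw : HasNoSwirl W) (y : EuclideanSpace ℝ (Fin 3)) :
    cylRadius y ^ 2 * (W y 0 ^ 2 + W y 1 ^ 2) = (y 0 * W y 0 + y 1 * W y 1) ^ 2 := by
  have h := hsw y
  rw [swirl] at h
  rw [cylRadius_sq]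
  linear_combination (y 0 * W y 1 - y 1 * W y 0) * h

/-- **`‖W‖² ≤ (y₀W₀ + y₁W₁)²/ϱ₀² + W₂²`** for a swirl-free field vanishing where `|x'| < ϱ₀`
(`ϱ₀ > 0`). [folklore] -/
theorem norm_sq_le_of_hasNoSwirl (hsw : HasNoSwirl W) {ρ₀ : ℝ} (h0 : 0 < ρ₀)
    (hsupp : ∀ y, W y ≠ 0 → ρ₀ ≤ cylRadius y) (y : EuclideanSpace ℝ (Fin 3)) :
    ‖W y‖ ^ 2 ≤ (y 0 * W y 0 + y 1 * W y 1) ^ 2 / ρ₀ ^ 2 + W y 2 ^ 2 := by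
  have hn : ‖W y‖ ^ 2 = W y 0 ^ 2 + W y 1 ^ 2 + W y 2 ^ 2 := by
    rw [EuclideanSpace.norm_sq_eq, Fin.sum_univ_three]
    simp only [Real.norm_eq_abs, sq_abs]
  by_cases hW : W y = 0
  · rw [hW, norm_zero]
    simp only [ne_eq, OfNat.ofNat_ne_zero, not_false_eq_true, zero_pow, PiLp.zero_apply,
      mul_zero, add_zero, zero_div]
    exact le_refl _
  · have hr : ρ₀ ≤ cylRadius y := hsupp y hW
    have hr0 : 0 < cylRadius y := h0.trans_le hr
    have hL := cylRadius_sq_mul_horizontal_sq hsw y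
    have hhor : W y 0 ^ 2 + W y 1 ^ 2 ≤ (y 0 * W y 0 + y 1 * W y 1) ^ 2 / ρ₀ ^ 2 := by
      rw [le_div_iff₀ (by positivity)]
      calc (W y 0 ^ 2 + W y 1 ^ 2) * ρ₀ ^ 2 ≤ (W y 0 ^ 2 + W y 1 ^ 2) * cylRadius y ^ 2 := by
            gcongr
        _ = (y 0 * W y 0 + y 1 * W y 1) ^ 2 := by rw [← hL]; ring
    rw [hn]
    linarith

/-- **The horizontal profile `A = y₀W₀ + y₁W₁` is `C¹`** with
`DA(y) h = y₀(DW h)₀ + h₀W₀ + y₁(DW h)₁ + h₁W₁`. [folklore] -/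
theorem hasFDerivAt_horizontalProfile (hW : Differentiable ℝ W) (y : EuclideanSpace ℝ (Fin 3)) :
    HasFDerivAt (fun x => x 0 * W x 0 + x 1 * W x 1)
      ((y 0 • ((EuclideanSpace.proj (0 : Fin 3) : EuclideanSpace ℝ (Fin 3) →L[ℝ] ℝ).comp (fderiv ℝ W y)) +
          W y 0 • (EuclideanSpace.proj (0 : Fin 3) : EuclideanSpace ℝ (Fin 3) →L[ℝ] ℝ)) +
        (y 1 • ((EuclideanSpace.proj (1 : Fin 3) : EuclideanSpace ℝ (Fin 3) →L[ℝ] ℝ).comp (fderiv ℝ W y)) +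
          W y 1 • (EuclideanSpace.proj (1 : Fin 3) : EuclideanSpace ℝ (Fin 3) →L[ℝ] ℝ))) y := by
  have h0 : HasFDerivAt (fun x : EuclideanSpace ℝ (Fin 3) => x 0) (EuclideanSpace.proj (0 : Fin 3) : EuclideanSpace ℝ (Fin 3) →L[ℝ] ℝ) y :=
    (EuclideanSpace.proj (0 : Fin 3) : EuclideanSpace ℝ (Fin 3) →L[ℝ] ℝ).hasFDerivAt
  have h1 : HasFDerivAt (fun x : EuclideanSpace ℝ (Fin 3) => x 1) (EuclideanSpace.proj (1 : Fin 3) : EuclideanSpace ℝ (Fin 3) →L[ℝ] ℝ) y :=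
    (EuclideanSpace.proj (1 : Fin 3) : EuclideanSpace ℝ (Fin 3) →L[ℝ] ℝ).hasFDerivAt
  have hW0 : HasFDerivAt (fun x => W x 0) ((EuclideanSpace.proj (0 : Fin 3) : EuclideanSpace ℝ (Fin 3) →L[ℝ] ℝ).comp (fderiv ℝ W y)) y :=
    (EuclideanSpace.proj (0 : Fin 3) : EuclideanSpace ℝ (Fin 3) →L[ℝ] ℝ).hasFDerivAt.comp y (hW y).hasFDerivAt
  have hW1 : HasFDerivAt (fun x => W x 1) ((EuclideanSpace.proj (1 : Fin 3) : EuclideanSpace ℝ (Fin 3) →L[ℝ] ℝ).comp (fderiv ℝ W y)) y :=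
    (EuclideanSpace.proj (1 : Fin 3) : EuclideanSpace ℝ (Fin 3) →L[ℝ] ℝ).hasFDerivAt.comp y (hW y).hasFDerivAt
  exact (h0.mul hW0).add (h1.mul hW1)

/-- **`‖DA(y)‖ ≤ ‖W y‖ + ϱ ‖DW(y)‖`** for the horizontal profile `A = y₀W₀ + y₁W₁`
(Cauchy–Schwarz in the horizontal plane). [folklore] -/
theorem norm_fderiv_horizontalProfile_le (hW : Differentiable ℝ W) (y : EuclideanSpace ℝ (Fin 3)) :
    ‖fderiv ℝ (fun x => x 0 * W x 0 + x 1 * W x 1) y‖ ≤ ‖W y‖ + cylRadius y * ‖fderiv ℝ W y‖ := by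
  rw [(hasFDerivAt_horizontalProfile hW y).fderiv]
  refine ContinuousLinearMap.opNorm_le_bound _
    (add_nonneg (norm_nonneg _) (mul_nonneg (cylRadius_nonneg y) (norm_nonneg _))) fun h => ?_
  have e : ((y 0 • ((EuclideanSpace.proj (0 : Fin 3) : EuclideanSpace ℝ (Fin 3) →L[ℝ] ℝ).comp (fderiv ℝ W y)) +
          W y 0 • (EuclideanSpace.proj (0 : Fin 3) : EuclideanSpace ℝ (Fin 3) →L[ℝ] ℝ)) +
        (y 1 • ((EuclideanSpace.proj (1 : Fin 3) : EuclideanSpace ℝ (Fin 3) →L[ℝ] ℝ).comp (fderiv ℝ W y)) +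
          W y 1 • (EuclideanSpace.proj (1 : Fin 3) : EuclideanSpace ℝ (Fin 3) →L[ℝ] ℝ))) h =
      (h 0 * W y 0 + h 1 * W y 1) + (y 0 * fderiv ℝ W y h 0 + y 1 * fderiv ℝ W y h 1) := by
    simp only [add_apply, smul_apply, smul_eq_mul, ContinuousLinearMap.coe_comp, comp_apply,
      PiLp.proj_apply]
    ring
  rw [e, Real.norm_eq_abs]
  refine (abs_add_le _ _).trans ?_
  have h1 := abs_horizontal_inner_le_cylRadius_mul h (W y)
  have h2 := abs_horizontal_inner_le_cylRadius_mul y (fderiv ℝ W y h)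
  have hh : cylRadius h ≤ ‖h‖ := by
    rw [cylRadius, EuclideanSpace.norm_eq]
    refine Real.sqrt_le_sqrt ?_
    simp only [Fin.sum_univ_three, Real.norm_eq_abs, sq_abs]
    nlinarith [sq_nonneg (h 2)]
  have h3 : ‖fderiv ℝ W y h‖ ≤ ‖fderiv ℝ W y‖ * ‖h‖ := ContinuousLinearMap.le_opNorm _ _
  calc |h 0 * W y 0 + h 1 * W y 1| + |y 0 * fderiv ℝ W y h 0 + y 1 * fderiv ℝ W y h 1|
      ≤ cylRadius h * ‖W y‖ + cylRadius y * ‖fderiv ℝ W y h‖ := add_le_add h1 h2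
    _ ≤ ‖h‖ * ‖W y‖ + cylRadius y * (‖fderiv ℝ W y‖ * ‖h‖) := by
        gcongr
        exact cylRadius_nonneg y
    _ = (‖W y‖ + cylRadius y * ‖fderiv ℝ W y‖) * ‖h‖ := by ring

/-- `|y₀W₀ + y₁W₁| ≤ ϱ ‖W y‖`. [folklore] -/
theorem abs_horizontalProfile_le (W : EuclideanSpace ℝ (Fin 3) → EuclideanSpace ℝ (Fin 3))
    (y : EuclideanSpace ℝ (Fin 3)) : |y 0 * W y 0 + y 1 * W y 1| ≤ cylRadius y * ‖W y‖ :=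
  abs_horizontal_inner_le_cylRadius_mul y (W y)

/-- The vertical profile `B = W₂` has `‖DB(y)‖ ≤ ‖DW(y)‖`. [folklore] -/
theorem norm_fderiv_apply_two_le (hW : Differentiable ℝ W) (y : EuclideanSpace ℝ (Fin 3)) :
    ‖fderiv ℝ (fun x => W x 2) y‖ ≤ ‖fderiv ℝ W y‖ := by
  have h : HasFDerivAt (fun x => W x 2) ((EuclideanSpace.proj (2 : Fin 3) : EuclideanSpace ℝ (Fin 3) →L[ℝ] ℝ).comp (fderiv ℝ W y)) y :=
    (EuclideanSpace.proj (2 : Fin 3) : EuclideanSpace ℝ (Fin 3) →L[ℝ] ℝ).hasFDerivAt.comp y (hW y).hasFDerivAt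
  rw [h.fderiv]
  refine ContinuousLinearMap.opNorm_le_bound _ (norm_nonneg _) fun v => ?_
  simp only [ContinuousLinearMap.coe_comp, comp_apply, PiLp.proj_apply]
  exact (PiLp.norm_apply_le (fderiv ℝ W y v) 2).trans (ContinuousLinearMap.le_opNorm _ _)

end Profiles

/-! ### The even moments -/

/-- **Even moments of swirl-free axially symmetric fields supported off the axis** (the
two-dimensional Sobolev step "and thus `∫∫ |Ṽ(x,t)|^q dϱ dx₃ ≤ Φ₄(q, 𝒜₂)`" of the proof of
Seregin–Zajaczkowski 2007, Lemma 4.2, for the cut-off poloidal part `Ṽ = V^a ψ`). For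
`0 < ϱ₀ ≤ ϱ₁` and `m ≥ 1` there is a constant `C ≥ 0` such that every `C¹` compactly supported,
axially symmetric, swirl-free vector field `W : ℝ³ → ℝ³` vanishing outside `{ϱ₀ ≤ |x'| ≤ ϱ₁}`
satisfies `∫ ‖W‖^{2m} ≤ C (∫ ‖W‖²) (∫ ‖DW‖² + ∫ ‖W‖²)^{m-1}`. Proof: module docstring.
[cite: SereginZajaczkowski2007, proof of Lemma 4.2, last display (arXiv p. 6)] -/
theorem exists_even_moment_const_of_hasNoSwirl {ρ₀ ρ₁ : ℝ} (h0 : 0 < ρ₀) (h01 : ρ₀ ≤ ρ₁)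
    (m : ℕ) (hm : 1 ≤ m) :
    ∃ C : ℝ, 0 ≤ C ∧ ∀ W : EuclideanSpace ℝ (Fin 3) → EuclideanSpace ℝ (Fin 3),
      ContDiff ℝ 1 W → HasCompactSupport W → IsAxisymmetric W → HasNoSwirl W →
      (∀ y, W y ≠ 0 → ρ₀ ≤ cylRadius y ∧ cylRadius y ≤ ρ₁) →
        ∫ y, ‖W y‖ ^ (2 * m) ≤ C * (∫ y, ‖W y‖ ^ 2) *
          ((∫ y, ‖fderiv ℝ W y‖ ^ 2) + ∫ y, ‖W y‖ ^ 2) ^ (m - 1) := by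
  obtain ⟨K, hK0, hK⟩ := exists_axisym_even_moment_const h0 h01 m hm
  have hρ₁ : 0 < ρ₁ := h0.trans_le h01
  have hm0 : m ≠ 0 := by omega
  -- the constant
  set M : ℝ := 2 * max 1 (ρ₁ ^ 2) with hM
  have hM1 : 1 ≤ M := by
    have : (1 : ℝ) ≤ max 1 (ρ₁ ^ 2) := le_max_left _ _
    linarith
  refine ⟨2 ^ (m - 1) * ((ρ₀ ^ 2)⁻¹ ^ m * (K * ρ₁ ^ 2 * M ^ (m - 1)) + K), by positivity, ?_⟩
  intro W hW hWc hWa hsw hsupp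
  have hWd : Differentiable ℝ W := hW.differentiable one_ne_zero
  have hWcont : Continuous W := hW.continuous
  have hDWcont : Continuous fun y => fderiv ℝ W y := hW.continuous_fderiv one_ne_zero
  have hDWc : HasCompactSupport fun y => fderiv ℝ W y := hWc.fderiv ℝ
  -- support on the closed shell, also for the derivative
  have hclosed : IsClosed {x : EuclideanSpace ℝ (Fin 3) | ρ₀ ≤ cylRadius x ∧ cylRadius x ≤ ρ₁} := by
    have : {x : EuclideanSpace ℝ (Fin 3) | ρ₀ ≤ cylRadius x ∧ cylRadius x ≤ ρ₁} =
        cylRadius ⁻¹' Icc ρ₀ ρ₁ := rfl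
    rw [this]
    exact isClosed_Icc.preimage continuous_cylRadius
  have htsupp : tsupport W ⊆ {x : EuclideanSpace ℝ (Fin 3) | ρ₀ ≤ cylRadius x ∧ cylRadius x ≤ ρ₁} :=
    closure_minimal (fun x hx => hsupp x hx) hclosed
  have hsuppD : ∀ x, fderiv ℝ W x ≠ 0 → ρ₀ ≤ cylRadius x ∧ cylRadius x ≤ ρ₁ := fun x hx =>
    htsupp (tsupport_fderiv_subset ℝ (subset_tsupport _ hx))
  -- the profiles
  obtain ⟨A, hA⟩ : ∃ A : EuclideanSpace ℝ (Fin 3) → ℝ, A = fun y => y 0 * W y 0 + y 1 * W y 1 :=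
    ⟨_, rfl⟩
  obtain ⟨B, hB⟩ : ∃ B : EuclideanSpace ℝ (Fin 3) → ℝ, B = fun y => W y 2 := ⟨_, rfl⟩
  have hA1 : ContDiff ℝ 1 A := by
    have h0 : ContDiff ℝ 1 (fun y : EuclideanSpace ℝ (Fin 3) => y 0) := (EuclideanSpace.proj (0 : Fin 3) : EuclideanSpace ℝ (Fin 3) →L[ℝ] ℝ).contDiff
    have h1 : ContDiff ℝ 1 (fun y : EuclideanSpace ℝ (Fin 3) => y 1) := (EuclideanSpace.proj (1 : Fin 3) : EuclideanSpace ℝ (Fin 3) →L[ℝ] ℝ).contDiff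
    have hW0 : ContDiff ℝ 1 (fun y => W y 0) := (EuclideanSpace.proj (0 : Fin 3) : EuclideanSpace ℝ (Fin 3) →L[ℝ] ℝ).contDiff.comp hW
    have hW1 : ContDiff ℝ 1 (fun y => W y 1) := (EuclideanSpace.proj (1 : Fin 3) : EuclideanSpace ℝ (Fin 3) →L[ℝ] ℝ).contDiff.comp hW
    rw [hA]
    exact (h0.mul hW0).add (h1.mul hW1)
  have hB1 : ContDiff ℝ 1 B := by
    rw [hB]
    exact (EuclideanSpace.proj (2 : Fin 3) : EuclideanSpace ℝ (Fin 3) →L[ℝ] ℝ).contDiff.comp hW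
  have hAsupp0 : ∀ y, W y = 0 → A y = 0 := fun y hy => by simp [hA, hy]
  have hBsupp0 : ∀ y, W y = 0 → B y = 0 := fun y hy => by simp [hB, hy]
  have hAc : HasCompactSupport A :=
    hWc.mono (fun y hy => by by_contra h; exact hy (hAsupp0 y (by simpa using h)))
  have hBc : HasCompactSupport B :=
    hWc.mono (fun y hy => by by_contra h; exact hy (hBsupp0 y (by simpa using h)))
  have hAa : IsAxisymmetricScalar A := fun θ y => by
    simp only [hA, hWa θ y]
    exact horizontal_inner_rotZ θ y (W y)
  have hBa : IsAxisymmetricScalar B := fun θ y => by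
    simp only [hB, hWa θ y, rotZ_apply_two]
  have hAs : ∀ y, A y ≠ 0 → ρ₀ ≤ cylRadius y ∧ cylRadius y ≤ ρ₁ := fun y hy =>
    hsupp y fun h => hy (hAsupp0 y h)
  have hBs : ∀ y, B y ≠ 0 → ρ₀ ≤ cylRadius y ∧ cylRadius y ≤ ρ₁ := fun y hy =>
    hsupp y fun h => hy (hBsupp0 y h)
  have hKA := hK A hA1 hAc hAa hAs
  have hKB := hK B hB1 hBc hBa hBs
  -- integrability of everything in sight (continuous, compactly supported)
  have cW2 : HasCompactSupport fun y => ‖W y‖ ^ 2 :=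
    hWc.norm.comp_left (g := fun t : ℝ => t ^ 2) (by simp)
  have cW2m : HasCompactSupport fun y => ‖W y‖ ^ (2 * m) :=
    hWc.norm.comp_left (g := fun t : ℝ => t ^ (2 * m)) (by simp [hm0])
  have cDW : HasCompactSupport fun y => ‖fderiv ℝ W y‖ ^ 2 :=
    hDWc.norm.comp_left (g := fun t : ℝ => t ^ 2) (by simp)
  have hIW2 : Integrable fun y => ‖W y‖ ^ 2 := (hWcont.norm.pow 2).integrable_of_hasCompactSupport cW2
  have hIW2m : Integrable fun y => ‖W y‖ ^ (2 * m) :=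
    (hWcont.norm.pow (2 * m)).integrable_of_hasCompactSupport cW2m
  have hIDW : Integrable fun y => ‖fderiv ℝ W y‖ ^ 2 :=
    (hDWcont.norm.pow 2).integrable_of_hasCompactSupport cDW
  have hAcont : Continuous A := hA1.continuous
  have hBcont : Continuous B := hB1.continuous
  have hDAcont : Continuous fun y => fderiv ℝ A y := hA1.continuous_fderiv one_ne_zero
  have hDBcont : Continuous fun y => fderiv ℝ B y := hB1.continuous_fderiv one_ne_zero
  have cA2 : HasCompactSupport fun y => A y ^ 2 := hAc.comp_left (g := fun t : ℝ => t ^ 2) (by simp)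
  have cB2 : HasCompactSupport fun y => B y ^ 2 := hBc.comp_left (g := fun t : ℝ => t ^ 2) (by simp)
  have cA2m : HasCompactSupport fun y => A y ^ (2 * m) :=
    hAc.comp_left (g := fun t : ℝ => t ^ (2 * m)) (by simp [hm0])
  have cB2m : HasCompactSupport fun y => B y ^ (2 * m) :=
    hBc.comp_left (g := fun t : ℝ => t ^ (2 * m)) (by simp [hm0])
  have cDA : HasCompactSupport fun y => ‖fderiv ℝ A y‖ ^ 2 :=
    (hAc.fderiv ℝ).norm.comp_left (g := fun t : ℝ => t ^ 2) (by simp)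
  have cDB : HasCompactSupport fun y => ‖fderiv ℝ B y‖ ^ 2 :=
    (hBc.fderiv ℝ).norm.comp_left (g := fun t : ℝ => t ^ 2) (by simp)
  have hIA2 : Integrable fun y => A y ^ 2 := (hAcont.pow 2).integrable_of_hasCompactSupport cA2
  have hIB2 : Integrable fun y => B y ^ 2 := (hBcont.pow 2).integrable_of_hasCompactSupport cB2
  have hIA2m : Integrable fun y => A y ^ (2 * m) :=
    (hAcont.pow (2 * m)).integrable_of_hasCompactSupport cA2m
  have hIB2m : Integrable fun y => B y ^ (2 * m) :=
    (hBcont.pow (2 * m)).integrable_of_hasCompactSupport cB2m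
  have hIDA : Integrable fun y => ‖fderiv ℝ A y‖ ^ 2 :=
    (hDAcont.norm.pow 2).integrable_of_hasCompactSupport cDA
  have hIDB : Integrable fun y => ‖fderiv ℝ B y‖ ^ 2 :=
    (hDBcont.norm.pow 2).integrable_of_hasCompactSupport cDB
  -- (1) `∫ A² ≤ ρ₁² ∫ ‖W‖²`, `∫ B² ≤ ∫ ‖W‖²`
  have hA2 : ∫ y, A y ^ 2 ≤ ρ₁ ^ 2 * ∫ y, ‖W y‖ ^ 2 := by
    rw [← integral_const_mul]
    refine integral_mono hIA2 (hIW2.const_mul _) fun y => ?_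
    dsimp only
    by_cases hy : W y = 0
    · simp [hAsupp0 y hy, hy]
    · have hr := (hsupp y hy).2
      have h := abs_horizontalProfile_le W y
      have hAy : A y = y 0 * W y 0 + y 1 * W y 1 := by rw [hA]
      rw [← hAy] at h
      have hab : |A y| ≤ ρ₁ * ‖W y‖ :=
        h.trans (mul_le_mul_of_nonneg_right hr (norm_nonneg _))
      calc A y ^ 2 = |A y| ^ 2 := (sq_abs _).symm
        _ ≤ (ρ₁ * ‖W y‖) ^ 2 := pow_le_pow_left₀ (abs_nonneg _) hab 2
        _ = ρ₁ ^ 2 * ‖W y‖ ^ 2 := by ring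
  have hB2 : ∫ y, B y ^ 2 ≤ ∫ y, ‖W y‖ ^ 2 := by
    refine integral_mono hIB2 hIW2 fun y => ?_
    have hBy : B y = W y 2 := by rw [hB]
    dsimp only
    rw [hBy]
    calc W y 2 ^ 2 = |W y 2| ^ 2 := (sq_abs _).symm
      _ ≤ ‖W y‖ ^ 2 := pow_le_pow_left₀ (abs_nonneg _)
          (by simpa [Real.norm_eq_abs] using PiLp.norm_apply_le (W y) 2) 2
  -- (2) `∫ ‖DA‖² ≤ M (∫ ‖DW‖² + ∫ ‖W‖²)`, `∫ ‖DB‖² ≤ ∫ ‖DW‖²`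
  have hDA : ∫ y, ‖fderiv ℝ A y‖ ^ 2 ≤ M * ((∫ y, ‖fderiv ℝ W y‖ ^ 2) + ∫ y, ‖W y‖ ^ 2) := by
    have hpt : ∀ y, ‖fderiv ℝ A y‖ ^ 2 ≤ M * (‖fderiv ℝ W y‖ ^ 2 + ‖W y‖ ^ 2) := by
      intro y
      by_cases hy : fderiv ℝ A y = 0
      · rw [hy, norm_zero]
        have : 0 ≤ M * (‖fderiv ℝ W y‖ ^ 2 + ‖W y‖ ^ 2) := by positivity
        simpa using this
      · -- `y ∈ tsupport A ⊆ tsupport W`, so `ϱ ≤ ρ₁`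
        have hyW : y ∈ tsupport W := by
          have h1 : y ∈ tsupport A := tsupport_fderiv_subset ℝ (subset_tsupport _ hy)
          exact closure_mono (fun z hz => by
            by_contra hz'
            exact hz (hAsupp0 z (by simpa using hz'))) h1
        have hr : cylRadius y ≤ ρ₁ := (htsupp hyW).2
        have h := norm_fderiv_horizontalProfile_le hWd y
        rw [← hA] at h
        have h' : ‖fderiv ℝ A y‖ ≤ ‖W y‖ + ρ₁ * ‖fderiv ℝ W y‖ :=
          h.trans (add_le_add le_rfl (mul_le_mul_of_nonneg_right hr (norm_nonneg _)))
        have hmax : ρ₁ ^ 2 ≤ max 1 (ρ₁ ^ 2) := le_max_right _ _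
        have hone : (1 : ℝ) ≤ max 1 (ρ₁ ^ 2) := le_max_left _ _
        calc ‖fderiv ℝ A y‖ ^ 2 ≤ (‖W y‖ + ρ₁ * ‖fderiv ℝ W y‖) ^ 2 :=
              pow_le_pow_left₀ (norm_nonneg _) h' 2
          _ ≤ 2 * ‖W y‖ ^ 2 + 2 * (ρ₁ ^ 2 * ‖fderiv ℝ W y‖ ^ 2) := by
              nlinarith [sq_nonneg (‖W y‖ - ρ₁ * ‖fderiv ℝ W y‖)]
          _ ≤ 2 * (max 1 (ρ₁ ^ 2) * ‖W y‖ ^ 2) +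
                2 * (max 1 (ρ₁ ^ 2) * ‖fderiv ℝ W y‖ ^ 2) := by
              gcongr
              · have := sq_nonneg ‖W y‖
                nlinarith
          _ = M * (‖fderiv ℝ W y‖ ^ 2 + ‖W y‖ ^ 2) := by rw [hM]; ring
    calc ∫ y, ‖fderiv ℝ A y‖ ^ 2 ≤ ∫ y, M * (‖fderiv ℝ W y‖ ^ 2 + ‖W y‖ ^ 2) :=
          integral_mono hIDA ((hIDW.add hIW2).const_mul M) hpt
      _ = M * ((∫ y, ‖fderiv ℝ W y‖ ^ 2) + ∫ y, ‖W y‖ ^ 2) := by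
          rw [integral_const_mul, integral_add hIDW hIW2]
  have hDB : ∫ y, ‖fderiv ℝ B y‖ ^ 2 ≤ ∫ y, ‖fderiv ℝ W y‖ ^ 2 :=
    integral_mono hIDB hIDW fun y => by
      have h := norm_fderiv_apply_two_le hWd y
      rw [← hB] at h
      exact pow_le_pow_left₀ (norm_nonneg _) h 2
  -- (3) pointwise `‖W‖^{2m} ≤ 2^{m-1} ((ρ₀²)⁻ᵐ A^{2m} + B^{2m})` and integration
  have hpt : ∀ y, ‖W y‖ ^ (2 * m) ≤
      2 ^ (m - 1) * ((ρ₀ ^ 2)⁻¹ ^ m * A y ^ (2 * m) + B y ^ (2 * m)) := by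
    intro y
    have h := norm_sq_le_of_hasNoSwirl hsw h0 (fun z hz => (hsupp z hz).1) y
    have hAy : A y = y 0 * W y 0 + y 1 * W y 1 := by rw [hA]
    have hBy : B y = W y 2 := by rw [hB]
    rw [← hAy, ← hBy] at h
    have ha : 0 ≤ A y ^ 2 / ρ₀ ^ 2 := by positivity
    have hb : 0 ≤ B y ^ 2 := by positivity
    calc ‖W y‖ ^ (2 * m) = (‖W y‖ ^ 2) ^ m := by rw [pow_mul]
      _ ≤ (A y ^ 2 / ρ₀ ^ 2 + B y ^ 2) ^ m := pow_le_pow_left₀ (by positivity) h m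
      _ ≤ 2 ^ (m - 1) * ((A y ^ 2 / ρ₀ ^ 2) ^ m + (B y ^ 2) ^ m) := add_pow_le ha hb m
      _ = 2 ^ (m - 1) * ((ρ₀ ^ 2)⁻¹ ^ m * A y ^ (2 * m) + B y ^ (2 * m)) := by
          rw [div_eq_mul_inv, mul_pow, ← pow_mul, ← pow_mul]
          ring
  have hint : ∫ y, ‖W y‖ ^ (2 * m) ≤
      2 ^ (m - 1) * ((ρ₀ ^ 2)⁻¹ ^ m * (∫ y, A y ^ (2 * m)) + ∫ y, B y ^ (2 * m)) := by
    calc ∫ y, ‖W y‖ ^ (2 * m)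
        ≤ ∫ y, 2 ^ (m - 1) * ((ρ₀ ^ 2)⁻¹ ^ m * A y ^ (2 * m) + B y ^ (2 * m)) :=
          integral_mono hIW2m (((hIA2m.const_mul _).add hIB2m).const_mul _) hpt
      _ = 2 ^ (m - 1) * ((ρ₀ ^ 2)⁻¹ ^ m * (∫ y, A y ^ (2 * m)) + ∫ y, B y ^ (2 * m)) := by
          rw [integral_const_mul, integral_add (hIA2m.const_mul _) hIB2m, integral_const_mul]
  -- (4) assembling
  set X : ℝ := ∫ y, ‖W y‖ ^ 2 with hX
  set Y : ℝ := (∫ y, ‖fderiv ℝ W y‖ ^ 2) + ∫ y, ‖W y‖ ^ 2 with hY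
  have hX0 : 0 ≤ X := integral_nonneg fun y => by positivity
  have hDW0 : 0 ≤ ∫ y, ‖fderiv ℝ W y‖ ^ 2 := integral_nonneg fun y => by positivity
  have hY0 : 0 ≤ Y := by positivity
  have hDA0 : 0 ≤ ∫ y, ‖fderiv ℝ A y‖ ^ 2 := integral_nonneg fun y => by positivity
  have hDB0 : 0 ≤ ∫ y, ‖fderiv ℝ B y‖ ^ 2 := integral_nonneg fun y => by positivity
  have hA2' : 0 ≤ ∫ y, A y ^ 2 := integral_nonneg fun y => by positivity
  have hB2' : 0 ≤ ∫ y, B y ^ 2 := integral_nonneg fun y => by positivity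
  have hAm : ∫ y, A y ^ (2 * m) ≤ K * (ρ₁ ^ 2 * X) * (M * Y) ^ (m - 1) :=
    calc ∫ y, A y ^ (2 * m) ≤ K * (∫ y, A y ^ 2) * (∫ y, ‖fderiv ℝ A y‖ ^ 2) ^ (m - 1) := hKA
      _ ≤ K * (ρ₁ ^ 2 * X) * (M * Y) ^ (m - 1) := by gcongr
  have hBm : ∫ y, B y ^ (2 * m) ≤ K * X * Y ^ (m - 1) :=
    calc ∫ y, B y ^ (2 * m) ≤ K * (∫ y, B y ^ 2) * (∫ y, ‖fderiv ℝ B y‖ ^ 2) ^ (m - 1) := hKB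
      _ ≤ K * X * (∫ y, ‖fderiv ℝ W y‖ ^ 2) ^ (m - 1) := by gcongr
      _ ≤ K * X * Y ^ (m - 1) := by
          gcongr
          rw [hY]
          linarith
  calc ∫ y, ‖W y‖ ^ (2 * m)
      ≤ 2 ^ (m - 1) * ((ρ₀ ^ 2)⁻¹ ^ m * (∫ y, A y ^ (2 * m)) + ∫ y, B y ^ (2 * m)) := hint
    _ ≤ 2 ^ (m - 1) * ((ρ₀ ^ 2)⁻¹ ^ m * (K * (ρ₁ ^ 2 * X) * (M * Y) ^ (m - 1)) +
          K * X * Y ^ (m - 1)) :=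
        mul_le_mul_of_nonneg_left
          (add_le_add (mul_le_mul_of_nonneg_left hAm (by positivity)) hBm) (by positivity)
    _ = 2 ^ (m - 1) * ((ρ₀ ^ 2)⁻¹ ^ m * (K * ρ₁ ^ 2 * M ^ (m - 1)) + K) * X * Y ^ (m - 1) := by
          rw [mul_pow]
          ring

end Literature.Analysis.FluidPDE
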